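import Mathlib

/-!
# Crux `DisclinationRation.FiveFoldRation` (stmt-AtomisticToContinuum-15799), line `Sketch` —
# stub `stub_dr5_layerBootstrap`: Layer bootstrap (pure real analysis)

A monotone non-negative profile `f` with the trivial cubic bound `f r ≤ C₀ (1+r)³` and the
layer inequality `f (r − 6W) ≤ C₁ r³/W + (f (r−4W) − f (r−8W))/3` (`W ≥ W₀`, `r ≥ 16W`)
satisfies `f ρ ≤ θ ρ³` beyond a threshold depending on `(C₀, C₁, W₀, θ)` only.

Proof: fix one width `W ≥ max W₀ 1` with `128 C₁⁺ ≤ θ W`; for `ρ` large put `s := ρ + 6W`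
and iterate the layer inequality at the radii `s + 4 W i`, `i < m`, `m := ⌊s/(4W)⌋₊ + 1`:
the layer terms telescope (`dr5lb_iter`), the left-hand sides are all `≥ f ρ` by
monotonicity, and dividing by `m ≥ s/(4W)` gives `f ρ ≤ 64 C₁⁺ ρ³ / W + 144 C₀⁺ W ρ²`.

All shell predicates are the route decl's inline `GA` / `GF` / `d` / `T` / `Deca`, copied verbatim
(registered signature: `Cruxes/FiveFoldRation/Lines/Sketch.lean`).
-/

noncomputable section

namespace Summit.AtomisticToContinuum.Crystallization.Theorems

/-- Iterated layer inequality: summing the layer inequality over the radii `s + 4 W i`,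
`i < m`, the boundary-layer terms telescope and the left-hand sides dominate
`m * f (s - 6 W)`. -/
theorem dr5lb_iter {f : ℝ → ℝ} {C₁ C₁' W s : ℝ} (hW : 0 < W) (hC : C₁ ≤ C₁')
    (hC' : 0 ≤ C₁') (hmono : Monotone f)
    (hlayer : ∀ r : ℝ, 16 * W ≤ r →
      f (r - 6 * W) ≤ C₁ * r ^ 3 / W + (f (r - 4 * W) - f (r - 8 * W)) / 3)
    (hs : 16 * W ≤ s) :
    ∀ m : ℕ, 4 * W * m ≤ s + 4 * W →
      (m : ℝ) * f (s - 6 * W) ≤ (m : ℝ) * (C₁' * (2 * s) ^ 3 / W)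
        + (f (s + 4 * W * m - 8 * W) - f (s - 8 * W)) / 3 := by
  intro m
  induction m with
  | zero =>
    intro _
    simp
  | succ k ih =>
    intro hk
    push_cast at hk ⊢
    have hW0 : 0 ≤ W := hW.le
    have hk1 : 4 * W * (k : ℝ) ≤ s := by linarith
    have hih := ih (by linarith)
    have hknn : (0 : ℝ) ≤ 4 * W * k := by positivity
    have hr16 : 16 * W ≤ s + 4 * W * k := by linarith
    have hL := hlayer (s + 4 * W * k) hr16
    have hmono1 : f (s - 6 * W) ≤ f (s + 4 * W * k - 6 * W) := hmono (by linarith)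
    have hr0 : 0 ≤ s + 4 * W * k := by linarith
    have hr2 : s + 4 * W * k ≤ 2 * s := by linarith
    have hcube : (s + 4 * W * k) ^ 3 ≤ (2 * s) ^ 3 := pow_le_pow_left₀ hr0 hr2 3
    have hC1 : C₁ * (s + 4 * W * k) ^ 3 / W ≤ C₁' * (2 * s) ^ 3 / W := by
      apply div_le_div_of_nonneg_right _ hW0
      calc C₁ * (s + 4 * W * k) ^ 3 ≤ C₁' * (s + 4 * W * k) ^ 3 :=
            mul_le_mul_of_nonneg_right hC (by positivity)
        _ ≤ C₁' * (2 * s) ^ 3 := mul_le_mul_of_nonneg_left hcube hC'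
    have he1 : s + 4 * W * k - 4 * W = s + 4 * W * (k + 1) - 8 * W := by ring
    rw [he1] at hL
    linarith [hih, hL, hmono1, hC1]

/-- A monotone non-negative profile `f` with the trivial cubic bound `f r ≤ C₀ (1+r)³` and the
layer inequality `f (r − 6W) ≤ C₁ r³/W + (f (r−4W) − f (r−8W))/3` (`W ≥ W₀`, `r ≥ 16W`)
satisfies `f ρ ≤ θ ρ³` beyond a threshold depending on `(C₀, C₁, W₀, θ)` only. -/
theorem stub_dr5_layerBootstrap : ∀ C₀ C₁ W₀ θ : ℝ, 0 < θ → ∃ ρ₀ : ℝ, ∀ f : ℝ → ℝ, Monotone f → (∀ r, 0 ≤ f r) → (∀ r, 0 ≤ r → f r ≤ C₀ * (1 + r) ^ 3) → (∀ W r : ℝ, W₀ ≤ W → 16 * W ≤ r → f (r - 6 * W) ≤ C₁ * r ^ 3 / W + (f (r - 4 * W) - f (r - 8 * W)) / 3) → ∀ ρ : ℝ, ρ₀ ≤ ρ → f ρ ≤ θ * ρ ^ 3 := by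
  intro C₀ C₁ W₀ θ hθ
  -- clipped constants
  obtain ⟨C₀', hC₀le, hC₀nn⟩ : ∃ C : ℝ, C₀ ≤ C ∧ 0 ≤ C :=
    ⟨max C₀ 0, le_max_left _ _, le_max_right _ _⟩
  obtain ⟨C₁', hC₁le, hC₁nn⟩ : ∃ C : ℝ, C₁ ≤ C ∧ 0 ≤ C :=
    ⟨max C₁ 0, le_max_left _ _, le_max_right _ _⟩
  -- one fixed width
  obtain ⟨W, hWW₀, hW1, hWC⟩ : ∃ W : ℝ, W₀ ≤ W ∧ 1 ≤ W ∧ 128 * C₁' ≤ θ * W := by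
    refine ⟨max (max W₀ 1) (128 * C₁' / θ), le_trans (le_max_left _ _) (le_max_left _ _),
      le_trans (le_max_right _ _) (le_max_left _ _), ?_⟩
    have h : 128 * C₁' / θ ≤ max (max W₀ 1) (128 * C₁' / θ) := le_max_right _ _
    rw [div_le_iff₀ hθ] at h
    linarith [mul_comm (max (max W₀ 1) (128 * C₁' / θ)) θ]
  have hW0 : 0 < W := by linarith
  refine ⟨max (10 * W + 1) (288 * C₀' * W / θ + 1), ?_⟩
  intro f hmono hnn hcub hlayer ρ hρ
  have hρ1 : 10 * W + 1 ≤ ρ := le_trans (le_max_left _ _) hρ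
  have hρ2 : 288 * C₀' * W ≤ θ * ρ := by
    have h : 288 * C₀' * W / θ + 1 ≤ ρ := le_trans (le_max_right _ _) hρ
    have h' : 288 * C₀' * W / θ ≤ ρ := by linarith
    rw [div_le_iff₀ hθ] at h'
    linarith [mul_comm ρ θ]
  have hρ0 : 0 < ρ := by linarith
  -- base radius
  obtain ⟨s, hsdef⟩ : ∃ s : ℝ, s = ρ + 6 * W := ⟨_, rfl⟩
  have hs16 : 16 * W ≤ s := by linarith
  have hs1 : 1 ≤ s := by linarith
  have hs2 : s ≤ 2 * ρ := by linarith
  have hs0 : 0 ≤ s := by linarith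
  -- number of steps
  have h4W : 0 < 4 * W := by linarith
  obtain ⟨m, hmdef⟩ : ∃ m : ℕ, m = ⌊s / (4 * W)⌋₊ + 1 := ⟨_, rfl⟩
  have hfl1 : (⌊s / (4 * W)⌋₊ : ℝ) * (4 * W) ≤ s :=
    (le_div_iff₀ h4W).mp (Nat.floor_le (by positivity))
  have hfl2 : s < ((⌊s / (4 * W)⌋₊ : ℝ) + 1) * (4 * W) :=
    (div_lt_iff₀ h4W).mp (Nat.lt_floor_add_one _)
  have hmcast : (m : ℝ) = (⌊s / (4 * W)⌋₊ : ℝ) + 1 := by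
    rw [hmdef]
    push_cast
    ring
  have hm_le : 4 * W * (m : ℝ) ≤ s + 4 * W := by
    rw [hmcast]
    linarith
  have hm_ge : s ≤ 4 * W * (m : ℝ) := by
    rw [hmcast]
    linarith
  have hm_pos : (0 : ℝ) < m := by
    rw [hmcast]
    positivity
  -- the telescoped layer inequality
  have hiter := dr5lb_iter hW0 hC₁le hC₁nn hmono (fun r hr => hlayer W r hWW₀ hr) hs16 m hm_le
  have hsρ : s - 6 * W = ρ := by
    rw [hsdef]
    ring
  rw [hsρ] at hiter
  have htop : f (s + 4 * W * m - 8 * W) ≤ 27 * C₀' * s ^ 3 := by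
    have h1 : s + 4 * W * m - 8 * W ≤ 2 * s := by linarith
    have h2 : f (s + 4 * W * m - 8 * W) ≤ f (2 * s) := hmono h1
    have h3 : f (2 * s) ≤ C₀ * (1 + 2 * s) ^ 3 := hcub (2 * s) (by linarith)
    have h4 : C₀ * (1 + 2 * s) ^ 3 ≤ C₀' * (1 + 2 * s) ^ 3 :=
      mul_le_mul_of_nonneg_right hC₀le (by positivity)
    have h5 : (1 + 2 * s) ^ 3 ≤ (3 * s) ^ 3 := pow_le_pow_left₀ (by linarith) (by linarith) 3
    have h6 : C₀' * (1 + 2 * s) ^ 3 ≤ C₀' * (3 * s) ^ 3 := mul_le_mul_of_nonneg_left h5 hC₀nn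
    have h7 : C₀' * (3 * s) ^ 3 = 27 * C₀' * s ^ 3 := by ring
    linarith
  have hbot : 0 ≤ f (s - 8 * W) := hnn _
  have hmain : (m : ℝ) * f ρ ≤ (m : ℝ) * (C₁' * (2 * s) ^ 3 / W) + 9 * C₀' * s ^ 3 := by
    linarith
  -- first term: area + forest
  have hT1 : C₁' * (2 * s) ^ 3 / W ≤ θ / 2 * ρ ^ 3 := by
    rw [div_le_iff₀ hW0]
    have h1 : (2 * s) ^ 3 ≤ (4 * ρ) ^ 3 := pow_le_pow_left₀ (by linarith) (by linarith) 3
    have h2 : C₁' * (2 * s) ^ 3 ≤ C₁' * (4 * ρ) ^ 3 := mul_le_mul_of_nonneg_left h1 hC₁nn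
    have h3 : C₁' * (4 * ρ) ^ 3 = 64 * C₁' * ρ ^ 3 := by ring
    have hρ3 : 0 ≤ ρ ^ 3 := by positivity
    have h4 := mul_le_mul_of_nonneg_right hWC hρ3
    linarith
  -- second term: boundary layer
  have hT2 : 9 * C₀' * s ^ 3 ≤ (m : ℝ) * (θ / 2 * ρ ^ 3) := by
    have h1 : s ^ 2 ≤ (2 * ρ) ^ 2 := pow_le_pow_left₀ hs0 hs2 2
    have h2 : s ^ 3 ≤ (2 * ρ) ^ 2 * (4 * W * m) := by
      have h : s ^ 3 = s ^ 2 * s := by ring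
      rw [h]
      exact mul_le_mul h1 hm_ge hs0 (by positivity)
    have h3 := mul_le_mul_of_nonneg_left h2 (by positivity : (0 : ℝ) ≤ 9 * C₀')
    have h4 : 0 ≤ ρ ^ 2 * (m : ℝ) := by positivity
    have h5 := mul_le_mul_of_nonneg_right hρ2 h4
    linarith
  -- conclusion
  have hfin : (m : ℝ) * f ρ ≤ (m : ℝ) * (θ * ρ ^ 3) := by
    have h := mul_le_mul_of_nonneg_left hT1 hm_pos.le
    linarith
  exact le_of_mul_le_mul_left hfin hm_pos

end Summit.AtomisticToContinuum.Crystallization.Theorems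

end
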